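import Literature.Computability.FineGrained.MinPlusToNegativeTriangleSweepTriples
import Literature.Computability.FineGrained.APSPToMinPlusProduct
import Literature.Computability.FineGrained.SubcubicEquivalences
import Literature.Computability.FineGrained.NegativeTriangleToAPSP
import HarnessLib

/-!
# APSP `≤₃` Negative Triangle (VW–W 2018, Thm. 4.2): the contract, the budgets, and Thm. 1.1

The end of the cell-sweep verification of Vassilevska Williams–Williams, J. ACM 65 (2018),
Thm. 1.1, direction (1) `≤₃` (3) — APSP `≤₃` Negative Triangle:

* `NegTriSweep.psNT_spec`: the product step `NegTriSweep.psNT c`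
  (`Literature.Computability.FineGrained.MinPlusToNegativeTriangleSweepProgram`) meets the contract
  `APSPPower.ProdSpec c (NegativeTriangle (6c + 11)) (psNT c) (2c + 8) wspNT T Q (3L) (9L² + 1)` of
  the square-and-multiply driver (`Literature.Computability.FineGrained.APSPPowerDriver`);
* `NegTriSweep.psNT_budget`: its budgets are subcubic — time and total query length
  `O(n^{17/6} log² n)`, oracle ledger `O(n^{3-ε/2} log² n)` (everything is a monomial in
  `r = n^{1/6}`: `L ≤ 3r`, `r ≤ L`, `(nb L)³ ≤ 27 r¹⁸`);
* **`APSP_fgReducible_negativeTriangle_holds`** (`c' = 6c + 11`), hence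
  `subcubicEquivalent_APSP_negativeTriangle_holds` and — with the corrected transfer property
  `trulySubTime_of_fgReducible_of_sizeFitsWord_holds` and the verified reverse reduction
  `negativeTriangle_fgReducible_APSP_holds` — the named fact of
  `Literature.Computability.FineGrained.Conjectures`:
  **`trulySubTime_APSP_iff_negativeTriangle_holds`** (VW–W Thm. 1.1 for APSP and Negative
  Triangle: "either all of them have truly subcubic algorithms, or none of them do").

## References

* V. Vassilevska Williams, R. R. Williams, *Subcubic equivalences between path, matrix, and
  triangle problems*, J. ACM 65 (2018), Art. 27: Thm. 1.1 (p. 27:3; p. 27:22), §2 p. 27:8, §4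
  p. 27:13, Thm. 4.2 (p. 27:14; proof pp. 27:17–18), Lemma 4.2 (p. 27:16). doi:10.1145/3186893
* V. Vassilevska Williams, *On some fine-grained questions in algorithms and complexity*, Proc.
  ICM 2018, §2, Def. 2.1 and the remark following it.
-/

namespace Literature.Computability.FineGrained.NegTriSweep

open Cryptography Cryptography.WordRAM Cryptography.WordRAM.SProg APSPPower Matrix NegTriStep

set_option linter.unusedSimpArgs false

/-! ## Word-size arithmetic -/

/-- `(k + 1) b ≤ b^{k+1}` for `b ≥ 2`. [folklore] -/
theorem succ_mul_le_pow {b : ℕ} (hb : 2 ≤ b) : ∀ k : ℕ, (k + 1) * b ≤ b ^ (k + 1)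
  | 0 => by simp
  | k + 1 => by
    have ih := succ_mul_le_pow hb k
    calc (k + 1 + 1) * b ≤ 2 * ((k + 1) * b) := by nlinarith
      _ ≤ b * b ^ (k + 1) := Nat.mul_le_mul hb ih
      _ = b ^ (k + 1 + 1) := by ring

/-- `L ≤ 2n` for `n ≥ 1`. [folklore] -/
theorem cL_le {n : ℕ} (hn : 1 ≤ n) : cL n ≤ 2 * n := by
  have hs : 1 ≤ Nat.size n := Nat.size_pos.2 (by omega)
  calc cL n = 2 ^ ((Nat.size n + 5) / 6) := rfl
    _ ≤ 2 ^ Nat.size n := Nat.pow_le_pow_right (by norm_num) (by omega)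
    _ ≤ 2 * n := (by
      have hs : 1 ≤ Nat.size n := Nat.size_pos.2 (by omega)
      have h1 : 2 ^ (Nat.size n - 1) ≤ n := Nat.lt_size.1 (by omega)
      have h2 : 2 ^ Nat.size n = 2 * 2 ^ (Nat.size n - 1) := by rw [← pow_succ']; congr 1; omega
      omega)

/-- `L⁶ ≤ 96 n` for `n ≥ 1`. [folklore] -/
theorem cL_pow_six_le {n : ℕ} (hn : 1 ≤ n) : cL n ^ 6 ≤ 96 * n := by
  calc cL n ^ 6 = 2 ^ (6 * ((Nat.size n + 5) / 6)) := by unfold cL; rw [← pow_mul, Nat.mul_comm]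
    _ ≤ 2 ^ (Nat.size n + 5) := Nat.pow_le_pow_right (by norm_num) (by omega)
    _ = 32 * 2 ^ Nat.size n := by rw [pow_add]; norm_num; ring
    _ ≤ 96 * n := by
        have hs : 1 ≤ Nat.size n := Nat.size_pos.2 (by omega)
        have h1 : 2 ^ (Nat.size n - 1) ≤ n := Nat.lt_size.1 (by omega)
        have h2 : 2 ^ Nat.size n = 2 * 2 ^ (Nat.size n - 1) := by rw [← pow_succ']; congr 1; omega
        omega

/-- `n < L⁶`. [folklore] -/
theorem lt_cL_pow_six (n : ℕ) : n < cL n ^ 6 := by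
  calc n < 2 ^ Nat.size n := Nat.lt_size_self n
    _ ≤ 2 ^ (6 * ((Nat.size n + 5) / 6)) := Nat.pow_le_pow_right (by norm_num) (by omega)
    _ = cL n ^ 6 := by unfold cL; rw [← pow_mul, Nat.mul_comm]

/-- `M ≤ (n + 2)^{2c+2}` for `n ≥ 1`. [folklore] -/
theorem cM_le {c n : ℕ} (hn : 1 ≤ n) : cM c n ≤ (n + 2) ^ (2 * c + 2) := by
  calc cM c n = (2 ^ Nat.size n) ^ (c + 1) := by unfold cM; rw [← pow_mul, Nat.mul_comm]
    _ ≤ (2 * n) ^ (c + 1) := Nat.pow_le_pow_left (by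
      have hs : 1 ≤ Nat.size n := Nat.size_pos.2 (by omega)
      have h1 : 2 ^ (Nat.size n - 1) ≤ n := Nat.lt_size.1 (by omega)
      have h2 : 2 ^ Nat.size n = 2 * 2 ^ (Nat.size n - 1) := by rw [← pow_succ']; congr 1; omega
      omega) _
    _ ≤ ((n + 2) ^ 2) ^ (c + 1) := Nat.pow_le_pow_left (by nlinarith) _
    _ = (n + 2) ^ (2 * c + 2) := by rw [← pow_mul]; ring_nf

/-- `n^{c+1} ≤ M`. [folklore] -/
theorem pow_le_cM (c n : ℕ) : n ^ (c + 1) ≤ cM c n := by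
  calc n ^ (c + 1) ≤ (2 ^ Nat.size n) ^ (c + 1) := Nat.pow_le_pow_left (Nat.lt_size_self n).le _
    _ = cM c n := by unfold cM; rw [← pow_mul, Nat.mul_comm]

/-- The workspace fits: `wspNT n ≤ (n + 2)^8`. [folklore] -/
theorem wspNT_le (n : ℕ) : wspNT n ≤ (n + 2) ^ 8 := by
  unfold wspNT
  rcases Nat.eq_zero_or_pos n with rfl | hn
  · simp [cL]
  · have hL := cL_le hn
    have : cL n * cL n ≤ 4 * (n * n) := by nlinarith
    calc 2 * (n * n) + 9 * (cL n * cL n) + 3 ≤ 38 * (n * n) + 3 := by omega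
      _ ≤ (n + 2) ^ 8 := by
        have h2 : 38 * (n * n) + 3 ≤ (n + 2) ^ 2 * (n + 2) ^ 2 * 4 := by nlinarith
        calc 38 * (n * n) + 3 ≤ (n + 2) ^ 2 * (n + 2) ^ 2 * 4 := h2
          _ ≤ (n + 2) ^ 2 * (n + 2) ^ 2 * (n + 2) ^ 4 := Nat.mul_le_mul_left _ (by
              calc 4 ≤ 2 ^ 4 := by norm_num
                _ ≤ (n + 2) ^ 4 := Nat.pow_le_pow_left (by omega) 4)
          _ = (n + 2) ^ 8 := by ring

/-- **The word-size side conditions of the step** from the driver's hypotheses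
`(n + 2)^{2c+8} < 2^w`. [folklore] -/
theorem caps_of_pow_lt {c n w : ℕ} (hn : 1 ≤ n) (hEw : (n + 2) ^ (2 * c + 8) < 2 ^ w) :
    n < 2 ^ w ∧ Nat.size n * (c + 1) < 2 ^ w ∧ 2 * (32 * cM c n + 9) < 2 ^ w ∧
      (n + cL n) * n + (n + cL n) < 2 ^ w ∧ cNB n * cNB n * cNB n < 2 ^ w := by
  have hb : 3 ≤ n + 2 := by omega
  have hE1 : n + 2 ≤ (n + 2) ^ (2 * c + 8) := by
    calc n + 2 = (n + 2) ^ 1 := (pow_one _).symm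
      _ ≤ (n + 2) ^ (2 * c + 8) := Nat.pow_le_pow_right (by omega) (by omega)
  have hsz : Nat.size n ≤ n := size_le_self n
  refine ⟨by omega, ?_, ?_, ?_, ?_⟩
  · have h1 : (c + 1) * (n + 2) ≤ (n + 2) ^ (c + 1) := succ_mul_le_pow (by omega) c
    have h2 : (n + 2) ^ (c + 1) ≤ (n + 2) ^ (2 * c + 8) := Nat.pow_le_pow_right (by omega) (by omega)
    have h3 : Nat.size n * (c + 1) ≤ n * (c + 1) := Nat.mul_le_mul_right _ hsz
    nlinarith
  · have hM := cM_le (c := c) hn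
    have h6 : 82 ≤ (n + 2) ^ 6 := le_trans (by norm_num : 82 ≤ 3 ^ 6) (Nat.pow_le_pow_left hb 6)
    have : 82 * cM c n ≤ (n + 2) ^ (2 * c + 8) := by
      calc 82 * cM c n ≤ (n + 2) ^ 6 * (n + 2) ^ (2 * c + 2) := Nat.mul_le_mul h6 hM
        _ = (n + 2) ^ (2 * c + 8) := by rw [← pow_add]; ring_nf
    have := one_le_cM c n
    omega
  · have hL := cL_le hn
    have h3 : (n + cL n) * n + (n + cL n) ≤ 3 * ((n + 2) * (n + 2)) := by nlinarith
    have h4 : 3 * ((n + 2) * (n + 2)) ≤ (n + 2) ^ 3 := by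
      rw [pow_succ, sq]; exact by nlinarith
    have h5 : (n + 2) ^ 3 ≤ (n + 2) ^ (2 * c + 8) := Nat.pow_le_pow_right (by omega) (by omega)
    omega
  · have hnb := cNB_le n hn
    have h1 : cNB n * cNB n * cNB n ≤ n * n * n := Nat.mul_le_mul (Nat.mul_le_mul hnb hnb) hnb
    have h2 : n * n * n < (n + 2) ^ 3 := by nlinarith
    have h3 : (n + 2) ^ 3 ≤ (n + 2) ^ (2 * c + 8) := Nat.pow_le_pow_right (by omega) (by omega)
    omega

/-! ## Decoding the searched values -/

/-- The decoded code is the code of the product entry (`encode_of_tval`). [folklore] -/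
theorem decode_eq {n M : ℕ} {X Y : Matrix (Fin n) (Fin n) (WithTop ℤ)} (hX : HasBoundedWeights X M)
    (hY : HasBoundedWeights Y M) (hM : 1 ≤ M) (i j : Fin n) :
    (if 4 * M < tval X Y M (8 * M) i j then 0 else zzCode (tval X Y M (8 * M) i j) (2 * M)) =
      encodeWithTopInt (minPlusProduct X Y i j) := by
  rw [encode_of_tval (P := 8 * M) hX hY (by omega)]
  by_cases h4 : 4 * M < tval X Y M (8 * M) i j
  · rw [if_pos h4, if_pos h4]
  · rw [if_neg h4, if_neg h4, zzCode]
    by_cases h2 : tval X Y M (8 * M) i j < 2 * M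
    · rw [if_pos h2, if_neg (by omega)]; omega
    · rw [if_neg h2, if_pos (by omega)]; omega

/-! ## The contract of the product step -/

/-- **The Negative-Triangle product step meets the contract** `APSPPower.ProdSpec` with
`E = 2c + 8`, workspace `wspNT n`, at most `cR c n · (nb³ + L² n²)` queries per call, each a
`NegativeTriangle (6c + 11)`-instance of size `3L` and length `9L² + 1`, within the stated time
(VW–W 2018, Thm. 4.2: "the product of two `n × n` matrices over `R` can be performed in
`O(n² · T(n^{1/3}) log W)` time", here with blocks of side `n^{1/6}`).
[cite: VassilevskaWilliamsWilliams2018, Thm. 4.2 (p. 27:14; proof pp. 27:17–18)] -/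
theorem psNT_spec (c : ℕ) : ProdSpec c (NegativeTriangle (6 * c + 11)) (psNT c) (2 * c + 8) wspNT
    (fun n => 4 * Nat.size n + 3 + 38 + (9 * (cL n * cL n) * 5 + 1) +
      (cR c n * (cNB n * cNB n * cNB n * (96 * (cL n * cL n) + 27) +
        n * n * (cL n * cL n * (cL n * cL n * 46 + 20) + 3) + 9 * (n * n) + 8 + 2) + 1) +
      (3 + (n * n * 20 + 1)) + 1)
    (fun n => cR c n * (cNB n * cNB n * cNB n + cL n * cL n * (n * n)))
    (fun n => 3 * cL n) (fun n => 9 * (cL n * cL n) + 1) := by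
  intro n w O S H qs X Y hO hn hEw hFw h2 h16 h17 h17F hhX hhY hX hY hbX hbY hbXY hz
  set F := S 9 with hFdef
  set pX := S 16 with hpXdef
  obtain ⟨hnw, hcs, hcapB, hcapN, hcapNB⟩ := caps_of_pow_lt (c := c) hn hEw
  have hcapW : F + wspNT n < 2 ^ w := hFw
  have hwsp : wspNT n = 2 * (n * n) + 9 * (cL n * cL n) + 3 := rfl
  have hL1 := one_le_cL n
  have hM1 := one_le_cM c n
  have hF : 100 ≤ F := by omega
  have hYF : pX + n * n + 1 + n * n < F := by rw [← h17]; exact h17F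
  have hXM : HasBoundedWeights X (cM c n) := fun i j => IsBddWeight.mono (hbX i j) (pow_le_cM c n)
  have hYM : HasBoundedWeights Y (cM c n) := fun i j => IsBddWeight.mono (hbY i j) (pow_le_cM c n)
  -- 1. bit length
  obtain ⟨S₁, hex₁, hS₁, h20₁, -⟩ := bitlen_spec (O := O) (H := H) (qs := qs) h2 hnw
  -- 2. setup
  obtain ⟨S₂, H₂, hex₂, hS₂, hR₂, h40₂, h71₂, h72₂, hH₂⟩ := setup_spec (O := O) (H := H) (qs := qs) c
    ((hS₁ 2 (by omega) (by omega)).trans h2) (hS₁ 9 (by omega) (by omega)) (hS₁ 16 (by omega) (by omega))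
    ((hS₁ 17 (by omega) (by omega)).trans h17) h20₁ hn hF hcs hcapB hcapW hcapN hcapNB
  -- 3. fill
  obtain ⟨S₃, H₃, hex₃, hS₃, hwF, hnwF⟩ := fill_spec (w := w) (O := O) (H := H₂) (qs := qs) (m := 9 * (cL n * cL n))
    (p := F + 2 * (n * n) + 1) (BIGC := 32 * cM c n + 9) hR₂.r24 h71₂ h72₂ (by omega) (by omega) (by omega)
  have hR₃ : Regs c n F pX S₃ := hR₂.of_agree fun i hi => hS₃ i (by omega) (by omega)
  have h40₃ : S₃ 40 = 4 * cM c n := (hS₃ 40 (by omega) (by omega)).trans h40₂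
  have hH₃lo : ∀ a, a < F + 2 * (n * n) → H₃ a = H a := fun a ha => by
    rw [hnwF a (Or.inl (by omega)), hH₂, Function.update_of_ne (by omega)]
  have hH₃hi : ∀ a, F + 2 * (n * n) + (9 * (cL n * cL n) + 1) ≤ a → H₃ a = H a := fun a ha => by
    rw [hnwF a (Or.inr (by omega)), hH₂, Function.update_of_ne (by omega)]
  have hst₃ : Static c n F H H₃ :=
    { below := fun a ha => hH₃lo a (by omega)
      hdr := by rw [hnwF _ (Or.inl (by omega)), hH₂, Function.update_self]
      bg := fun u v hu hv _ _ _ => by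
        have := qcell_bounds (F := F) (n := n) hu hv
        exact hwF _ this.1 (by unfold qcell at this ⊢; omega)
      above := fun a ha => by rw [hH₃hi a (by omega)]; exact hz a (by omega)
      fd_le := fun t ht => by rw [hH₃lo _ (by omega), hz _ (by omega)]; exact Nat.zero_le _ }
  -- 4. the rounds
  obtain ⟨S₅, H₅, bs, hex₅, hS₅, hst₅, hlo₅, hlen₅, hsz₅, hel₅⟩ := rounds_spec (O := O) (qs := qs) (H₀ := H)
    hR₃ h40₃ hn hF h16 hYF hst₃ hX (by rw [← h17]; exact hY) hXM hYM
    (fun t ht => by rw [hH₃lo _ (by omega)]; exact hz _ (by omega))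
    (fun t ht => by rw [hH₃lo _ (by omega)]; exact hz _ (by omega)) hO hcapB hcapN hcapW hcapNB
  have hR₅ : Regs c n F pX S₅ := hR₃.of_agree hS₅
  -- 5. decoding
  obtain ⟨S₆, H₆, hex₆, hS₆, hdec, hnw₆⟩ := decode_spec (w := w) (O := O) (S := S₅) (H := H₅)
    (qs := qs ++ bs.map (NegativeTriangle (6 * c + 11)).encode) (M4 := 4 * cM c n)
    hR₅.r9 hR₅.r14 hR₅.r15 hR₅.r16 hR₅.r22 hR₅.r35 h16 (by omega) (by omega)
    (fun t ht => by
      have hi' : t / n < n := Nat.div_lt_of_lt_mul (by rwa [Nat.mul_comm] at ht)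
      have hj' : t % n < n := Nat.mod_lt _ (by omega)
      have := hlo₅ ⟨t / n, hi'⟩ ⟨t % n, hj'⟩
      simp only at this; rw [Nat.div_add_mod' t n] at this; rw [this]
      have := tval_lt (P := 8 * cM c n) hXM hYM (by omega) ⟨t / n, hi'⟩ ⟨t % n, hj'⟩; omega)
    (by omega) (by omega)
  -- 6. the free pointer
  have h32₆ : S₆ 32 = F + 2 * (n * n) + (9 * (cL n * cL n) + 1) := (hS₆ 32 (by omega)).trans hR₅.r32
  obtain ⟨st₇, hex₇, S₇, rfl, hS₇, h9₇⟩ : ∃ st₇, Exec w O (block [(.add, .dir 9, .dir 32, .imm 2)])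
      ⟨merge S₆ H₆, qs ++ bs.map (NegativeTriangle (6 * c + 11)).encode⟩ st₇ 1 ∧
      ∃ S₇, st₇ = ⟨merge S₇ H₆, qs ++ bs.map (NegativeTriangle (6 * c + 11)).encode⟩ ∧
        (∀ i, i ≠ 9 → S₇ i = S₆ i) ∧ S₇ 9 = F + wspNT n := by
    refine Exec.block_of_fwd _ _ fun R hR' => ?_
    have htmp := execOps_cons_fwd hR'; clear hR'; obtain ⟨v1, hv1, hR'⟩ := htmp
    simp -failIfUnchanged (disch := omega) only [Operand.write, Operand.read, merge_apply_of_lt,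
      merge_apply_of_le, Function.update_self, Function.update_of_ne, update_merge_of_lt,
      update_merge_of_le, Nat.add_zero, BinOp.eval_add_of_lt, h32₆] at hv1 hR'
    simp only [execOps_nil] at hR'; subst hR'; subst hv1
    exact ⟨_, rfl, fun i hi => by simp [Function.update_of_ne, hi], by simp [hwsp]; omega⟩
  -- assemble
  refine ⟨S₇, H₆, bs, ?_, fun r hr hr9 => ?_, h9₇, ?_, fun a ha hout => ?_, fun a ha => ?_, hlen₅, hsz₅,
    fun y hy => (hel₅ y hy).le⟩
  · unfold psNT
    have := hex₁.seqs_cons (hex₂.execLE.seqs_cons (hex₃.seqs_cons (hex₅.seqs_cons (hex₆.seqs_cons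
      (ExecLE.seqs_one hex₇.execLE)))))
    exact this.mono (by beta_reduce; omega)
  · rw [hS₇ r hr9, hS₆ r (by omega), hS₅ r (by omega), hS₃ r (by omega) (by omega), hS₂ r (by omega),
      hS₁ r (by omega) (by omega)]
  · intro i j
    rw [hdec _ (NegTriToAPSP.mul_add_lt_mul i.isLt j.isLt), hlo₅ i j]
    exact decode_eq hXM hYM hM1 i j
  · rw [hnw₆ a (by omega)]
    exact hst₅.below a ha
  · rw [h9₇] at ha
    rw [hnw₆ a (by omega)]
    exact hst₅.above a ha

end Literature.Computability.FineGrained.NegTriSweep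

namespace Literature.Computability.FineGrained.NegTriSweep

open Cryptography Cryptography.WordRAM Cryptography.WordRAM.SProg APSPPower Matrix NegTriStep

/-! ## The budgets of the step: natural-number bounds -/

/-- The time of the driver with the Negative-Triangle step, bounded by the two dominant terms
`nb³ L²` (building the queries of all block triples) and `n² L⁴` (the cell sweeps). [folklore] -/
theorem time_le {s R L nb N : ℕ} (hs : 1 ≤ s) (hsR : s ≤ R) (hL : 1 ≤ L) (hN : 1 ≤ N) :
    38 * (N * N) + 45 + s * (2 * (4 * s + 3 + 38 + (9 * (L * L) * 5 + 1) +
      (R * (nb * nb * nb * (96 * (L * L) + 27) + N * N * (L * L * (L * L * 46 + 20) + 3) + 9 * (N * N) + 8 + 2) + 1) +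
      (3 + (N * N * 20 + 1)) + 1) + 6 * (N * N) + 18) + 1 ≤
    s * R * (246 * (nb * nb * nb * (L * L)) + 522 * (N * N * (L * L * (L * L)))) := by
  set P := nb * nb * nb * (L * L) with hP
  set W := N * N * (L * L * (L * L)) with hW
  have hL2 : 1 ≤ L * L := Nat.one_le_iff_ne_zero.2 (by positivity)
  have hN2 : 1 ≤ N * N := Nat.one_le_iff_ne_zero.2 (by positivity)
  have h1 : nb * nb * nb ≤ P := Nat.le_mul_of_pos_right _ hL2
  have h2 : N * N * (L * L) ≤ W := by
    calc N * N * (L * L) = N * N * (L * L) * 1 := (Nat.mul_one _).symm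
      _ ≤ N * N * (L * L) * (L * L) := Nat.mul_le_mul_left _ hL2
      _ = W := by rw [hW]; ring
  have h3 : N * N ≤ W := le_trans (Nat.le_mul_of_pos_right _ hL2) h2
  have h4 : L * L ≤ W := le_trans (Nat.le_mul_of_pos_left _ hN2) h2
  have h5 : 1 ≤ W := le_trans hN2 h3
  have h1R : 1 ≤ R := le_trans hs hsR
  have hRW : R ≤ R * W := Nat.le_mul_of_pos_right _ h5
  have eTr : nb * nb * nb * (96 * (L * L) + 27) + N * N * (L * L * (L * L * 46 + 20) + 3) + 9 * (N * N) + 8 + 2 =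
      96 * P + 27 * (nb * nb * nb) + 46 * W + 20 * (N * N * (L * L)) + 12 * (N * N) + 10 := by
    rw [hP, hW]; ring
  have hTr : nb * nb * nb * (96 * (L * L) + 27) + N * N * (L * L * (L * L * 46 + 20) + 3) + 9 * (N * N) + 8 + 2 ≤
      123 * P + 88 * W := by rw [eTr]; omega
  have hRTr : R * (nb * nb * nb * (96 * (L * L) + 27) + N * N * (L * L * (L * L * 46 + 20) + 3) + 9 * (N * N) + 8 + 2) ≤
      123 * (R * P) + 88 * (R * W) := by
    calc _ ≤ R * (123 * P + 88 * W) := Nat.mul_le_mul_left _ hTr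
      _ = 123 * (R * P) + 88 * (R * W) := by ring
  have hL2RW : L * L ≤ R * W := le_trans h4 (Nat.le_mul_of_pos_left _ h1R)
  have hN2RW : N * N ≤ R * W := le_trans h3 (Nat.le_mul_of_pos_left _ h1R)
  have h1RW : 1 ≤ R * W := le_trans h1R hRW
  have hsRW : s ≤ R * W := le_trans hsR hRW
  have hT : 4 * s + 3 + 38 + (9 * (L * L) * 5 + 1) +
      (R * (nb * nb * nb * (96 * (L * L) + 27) + N * N * (L * L * (L * L * 46 + 20) + 3) + 9 * (N * N) + 8 + 2) + 1) +
      (3 + (N * N * 20 + 1)) + 1 ≤ 123 * (R * P) + 205 * (R * W) := by omega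
  have hsRW' : s * (R * W) = s * R * W := by rw [Nat.mul_assoc]
  have hsRP' : s * (R * P) = s * R * P := by rw [Nat.mul_assoc]
  have hN2s : N * N ≤ s * R * W := le_trans hN2RW (by rw [← hsRW']; exact Nat.le_mul_of_pos_left _ hs)
  have h1s : 1 ≤ s * R * W := le_trans h1RW (by rw [← hsRW']; exact Nat.le_mul_of_pos_left _ hs)
  have key : s * (2 * (4 * s + 3 + 38 + (9 * (L * L) * 5 + 1) +
      (R * (nb * nb * nb * (96 * (L * L) + 27) + N * N * (L * L * (L * L * 46 + 20) + 3) + 9 * (N * N) + 8 + 2) + 1) +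
      (3 + (N * N * 20 + 1)) + 1) + 6 * (N * N) + 18) ≤ 246 * (s * R * P) + 434 * (s * R * W) := by
    calc _ ≤ s * (2 * (123 * (R * P) + 205 * (R * W)) + 6 * (R * W) + 18 * (R * W)) :=
          Nat.mul_le_mul_left _ (by omega)
      _ = 246 * (s * (R * P)) + 434 * (s * (R * W)) := by ring
      _ = 246 * (s * R * P) + 434 * (s * R * W) := by rw [hsRW', hsRP']
  calc _ ≤ 84 * (s * R * W) + (246 * (s * R * P) + 434 * (s * R * W)) + 4 * (s * R * W) := by omega
    _ = s * R * (246 * P + 522 * W) := by ring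

/-- `nb L < 3n`. [folklore] -/
theorem cNB_mul_cL_lt {n : ℕ} (hn : 1 ≤ n) : cNB n * cL n < 3 * n := by
  have h1 := cNB_mul_le n
  have h2 := cL_le hn
  have hL := one_le_cL n
  omega

/-- `1 ≤ size n ≤ cR c n ≤ (c + 4) size n` for `n ≥ 1`. [folklore] -/
theorem size_cR {c n : ℕ} (hn : 1 ≤ n) : 1 ≤ Nat.size n ∧ Nat.size n ≤ cR c n ∧ cR c n ≤ (c + 4) * Nat.size n := by
  have hs : 1 ≤ Nat.size n := Nat.size_pos.2 (by omega)
  refine ⟨hs, ?_, ?_⟩ <;> unfold cR <;> nlinarith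

/-! ## The budgets of the step: the real estimates -/

/-- **The sixth root of `n`** and the parameters: with `r = n^{1/6}` (`n ≥ 1`), `r ≥ 1`,
`n^a = r^{6a}`, `L ≤ 3r`, `r ≤ L`, and the dominant terms are monomials:
`nb³ L² ≤ 27 r¹⁷`, `n² L⁴ ≤ 81 r¹⁷`, `(nb L)³ + L⁵ n² ≤ 270 r¹⁸`. [folklore] -/
theorem sixth_root {n : ℕ} (hn : 1 ≤ n) :
    1 ≤ (n : ℝ) ^ ((1 : ℝ) / 6) ∧ (∀ a : ℝ, (n : ℝ) ^ a = ((n : ℝ) ^ ((1 : ℝ) / 6)) ^ (6 * a)) ∧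
      (cL n : ℝ) ≤ 3 * (n : ℝ) ^ ((1 : ℝ) / 6) ∧ (n : ℝ) ^ ((1 : ℝ) / 6) ≤ cL n ∧
      (cNB n : ℝ) ^ (3 : ℕ) * (cL n : ℝ) ^ (2 : ℕ) ≤ 27 * ((n : ℝ) ^ ((1 : ℝ) / 6)) ^ (17 : ℕ) ∧
      (n : ℝ) ^ (2 : ℕ) * (cL n : ℝ) ^ (4 : ℕ) ≤ 81 * ((n : ℝ) ^ ((1 : ℝ) / 6)) ^ (17 : ℕ) ∧
      ((cNB n : ℝ) * cL n) ^ (3 : ℕ) + (cL n : ℝ) ^ (5 : ℕ) * (n : ℝ) ^ (2 : ℕ) ≤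
        270 * ((n : ℝ) ^ ((1 : ℝ) / 6)) ^ (18 : ℕ) := by
  set L := cL n with hLdef
  set nb := cNB n with hnbdef
  have hn0 : (0 : ℝ) < n := by exact_mod_cast hn
  have hn1 : (1 : ℝ) ≤ n := by exact_mod_cast hn
  set r := (n : ℝ) ^ ((1 : ℝ) / 6) with hrdef
  have hr1 : 1 ≤ r := Real.one_le_rpow hn1 (by norm_num)
  have hr0 : 0 < r := by linarith
  have hr6 : r ^ (6 : ℕ) = n := by
    rw [hrdef, ← Real.rpow_natCast, ← Real.rpow_mul hn0.le]; norm_num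
  have hrpow : ∀ a : ℝ, (n : ℝ) ^ a = r ^ (6 * a) := fun a => by
    rw [hrdef, ← Real.rpow_mul hn0.le]; ring_nf
  have hL0 : (0 : ℝ) ≤ L := Nat.cast_nonneg _
  have hL6 : (L : ℝ) ^ (6 : ℕ) ≤ (3 * r) ^ (6 : ℕ) := by
    have h' : ((cL n ^ 6 : ℕ) : ℝ) ≤ ((96 * n : ℕ) : ℝ) := by exact_mod_cast cL_pow_six_le hn
    push_cast at h'
    calc (L : ℝ) ^ 6 ≤ 96 * n := h'
      _ ≤ 729 * n := by nlinarith
      _ = (3 * r) ^ 6 := by rw [mul_pow, hr6]; norm_num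
  have hL3r : (L : ℝ) ≤ 3 * r := le_of_pow_le_pow_left₀ (by norm_num) (by positivity) hL6
  have hrL6 : r ^ (6 : ℕ) ≤ (L : ℝ) ^ (6 : ℕ) := by
    rw [hr6]; exact_mod_cast (lt_cL_pow_six n).le
  have hrL : r ≤ L := le_of_pow_le_pow_left₀ (by norm_num) hL0 hrL6
  have hPL : ((nb : ℝ) * L) ^ (3 : ℕ) ≤ 27 * r ^ (18 : ℕ) := by
    have h' : ((cNB n * cL n : ℕ) : ℝ) ≤ ((3 * n : ℕ) : ℝ) := by exact_mod_cast (cNB_mul_cL_lt hn).le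
    push_cast at h'
    calc ((nb : ℝ) * L) ^ 3 ≤ (3 * (n : ℝ)) ^ 3 := pow_le_pow_left₀ (by positivity) h' 3
      _ = 27 * r ^ 18 := by rw [mul_pow, ← hr6]; ring
  have hP : (nb : ℝ) ^ (3 : ℕ) * (L : ℝ) ^ (2 : ℕ) ≤ 27 * r ^ (17 : ℕ) := by
    have h1 : (nb : ℝ) ^ 3 * L ^ 2 * L ≤ 27 * r ^ 17 * r := by
      calc (nb : ℝ) ^ 3 * L ^ 2 * L = ((nb : ℝ) * L) ^ 3 := by ring
        _ ≤ 27 * r ^ 18 := hPL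
        _ = 27 * r ^ 17 * r := by ring
    have h2 : (nb : ℝ) ^ 3 * L ^ 2 * r ≤ (nb : ℝ) ^ 3 * L ^ 2 * L :=
      mul_le_mul_of_nonneg_left hrL (by positivity)
    exact le_of_mul_le_mul_right (h2.trans h1) hr0
  have hW : (n : ℝ) ^ (2 : ℕ) * (L : ℝ) ^ (4 : ℕ) ≤ 81 * r ^ (17 : ℕ) := by
    calc (n : ℝ) ^ 2 * L ^ 4 ≤ (n : ℝ) ^ 2 * (3 * r) ^ 4 := by gcongr
      _ = 81 * r ^ 16 := by rw [← hr6]; ring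
      _ ≤ 81 * r ^ 17 := by nlinarith [pow_le_pow_right₀ hr1 (show 16 ≤ 17 by norm_num)]
  have hL5 : ((nb : ℝ) * L) ^ (3 : ℕ) + (L : ℝ) ^ (5 : ℕ) * (n : ℝ) ^ (2 : ℕ) ≤ 270 * r ^ (18 : ℕ) := by
    have : (L : ℝ) ^ 5 * n ^ 2 ≤ 243 * r ^ 18 := by
      calc (L : ℝ) ^ 5 * n ^ 2 ≤ (3 * r) ^ 5 * n ^ 2 := by gcongr
        _ = 243 * r ^ 17 := by rw [← hr6]; ring
        _ ≤ 243 * r ^ 18 := by nlinarith [pow_le_pow_right₀ hr1 (show 17 ≤ 18 by norm_num)]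
    linarith
  exact ⟨hr1, hrpow, hL3r, hrL, hP, hW, hL5⟩

/-- **The logarithmic factors**: `size n · cR c n ≤ (c + 4) K² r^{12η}` whenever
`size n ≤ K n^η`. [folklore] -/
theorem log_factors {c n : ℕ} (hn : 1 ≤ n) {K η : ℝ} (hK : 0 ≤ K) (hN : (Nat.size n : ℝ) ≤ K * (n : ℝ) ^ η) :
    (Nat.size n : ℝ) * cR c n ≤ (c + 4) * K ^ 2 * ((n : ℝ) ^ ((1 : ℝ) / 6)) ^ (12 * η) := by
  obtain ⟨hr1, hrpow, -⟩ := sixth_root hn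
  obtain ⟨-, -, hRs⟩ := size_cR (c := c) hn
  set r := (n : ℝ) ^ ((1 : ℝ) / 6)
  have hr0 : 0 < r := by linarith
  have hsz0 : (0 : ℝ) ≤ Nat.size n := Nat.cast_nonneg _
  have hs : (Nat.size n : ℝ) ≤ K * r ^ (6 * η) := by rw [← hrpow]; exact hN
  have hRs' : (cR c n : ℝ) ≤ (c + 4) * Nat.size n := by
    have : ((cR c n : ℕ) : ℝ) ≤ (((c + 4) * Nat.size n : ℕ) : ℝ) := by exact_mod_cast hRs
    push_cast at this; exact this
  have hc4 : (0 : ℝ) ≤ c + 4 := by positivity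
  have h0 : 0 ≤ K * r ^ (6 * η) := by positivity
  calc (Nat.size n : ℝ) * cR c n ≤ Nat.size n * ((c + 4) * Nat.size n) := mul_le_mul_of_nonneg_left hRs' hsz0
    _ = (c + 4) * (Nat.size n * Nat.size n) := by ring
    _ ≤ (c + 4) * ((K * r ^ (6 * η)) * (K * r ^ (6 * η))) :=
        mul_le_mul_of_nonneg_left (mul_le_mul hs hs hsz0 h0) hc4
    _ = (c + 4) * K ^ 2 * (r ^ (6 * η) * r ^ (6 * η)) := by ring
    _ = (c + 4) * K ^ 2 * r ^ (12 * η) := by rw [← Real.rpow_add hr0]; ring_nf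

/-- **The time of the driver with the Negative-Triangle step**, for `n ≥ 1`:
`Tdrv T n + 1 ≤ 48924 · (size n · cR c n) · r¹⁷`. [folklore] -/
theorem time_real {c n : ℕ} (hn : 1 ≤ n) :
    ((Tdrv (fun n => 4 * Nat.size n + 3 + 38 + (9 * (cL n * cL n) * 5 + 1) +
      (cR c n * (cNB n * cNB n * cNB n * (96 * (cL n * cL n) + 27) +
        n * n * (cL n * cL n * (cL n * cL n * 46 + 20) + 3) + 9 * (n * n) + 8 + 2) + 1) +
      (3 + (n * n * 20 + 1)) + 1) n + 1 : ℕ) : ℝ) ≤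
      48924 * ((Nat.size n : ℝ) * cR c n) * ((n : ℝ) ^ ((1 : ℝ) / 6)) ^ (17 : ℕ) := by
  obtain ⟨hr1, -, -, -, hP, hW, -⟩ := sixth_root hn
  obtain ⟨hs1, hsR, -⟩ := size_cR (c := c) hn
  have hTn := time_le (R := cR c n) (L := cL n) (nb := cNB n) (N := n) hs1 hsR (one_le_cL n) hn
  have h1 : ((Tdrv (fun n => 4 * Nat.size n + 3 + 38 + (9 * (cL n * cL n) * 5 + 1) +
        (cR c n * (cNB n * cNB n * cNB n * (96 * (cL n * cL n) + 27) +
          n * n * (cL n * cL n * (cL n * cL n * 46 + 20) + 3) + 9 * (n * n) + 8 + 2) + 1) +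
        (3 + (n * n * 20 + 1)) + 1) n + 1 : ℕ) : ℝ) ≤
        ((Nat.size n * cR c n * (246 * (cNB n * cNB n * cNB n * (cL n * cL n)) +
          522 * (n * n * (cL n * cL n * (cL n * cL n)))) : ℕ) : ℝ) := by
    exact_mod_cast hTn
  refine h1.trans ?_
  push_cast
  have hsR0 : (0 : ℝ) ≤ (Nat.size n : ℝ) * cR c n := by positivity
  calc (Nat.size n : ℝ) * cR c n * (246 * (cNB n * cNB n * cNB n * (cL n * cL n)) +
        522 * (n * n * (cL n * cL n * (cL n * cL n))))
      = ((Nat.size n : ℝ) * cR c n) * (246 * ((cNB n : ℝ) ^ 3 * (cL n : ℝ) ^ 2) +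
          522 * ((n : ℝ) ^ 2 * (cL n : ℝ) ^ 4)) := by ring
    _ ≤ ((Nat.size n : ℝ) * cR c n) * (246 * (27 * ((n : ℝ) ^ ((1 : ℝ) / 6)) ^ 17) +
          522 * (81 * ((n : ℝ) ^ ((1 : ℝ) / 6)) ^ 17)) := by gcongr
    _ = 48924 * ((Nat.size n : ℝ) * cR c n) * ((n : ℝ) ^ ((1 : ℝ) / 6)) ^ 17 := by ring

/-- **The oracle ledger of the step**, for `n ≥ 1`:
`2 size n · Q n · ((3L)³)^{1-ε} ≤ 14580 · (size n · cR c n) · r¹⁸ · r^{-3ε}`. [folklore] -/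
theorem ledger_real {c n : ℕ} (hn : 1 ≤ n) {ε : ℝ} (hε : 0 < ε) :
    ((2 * Nat.size n * (cR c n * (cNB n * cNB n * cNB n + cL n * cL n * (n * n))) : ℕ) : ℝ) *
        ((((3 * cL n : ℕ) : ℕ) : ℝ) ^ (3 : ℝ)) ^ (1 - ε) ≤
      14580 * ((Nat.size n : ℝ) * cR c n) * (((n : ℝ) ^ ((1 : ℝ) / 6)) ^ (18 : ℕ) *
        ((n : ℝ) ^ ((1 : ℝ) / 6)) ^ (-(3 * ε))) := by
  obtain ⟨hr1, -, -, hrL, -, -, hL5⟩ := sixth_root hn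
  set r := (n : ℝ) ^ ((1 : ℝ) / 6) with hrdef
  have hr0 : 0 < r := by linarith
  have hL0 : (0 : ℝ) ≤ cL n := Nat.cast_nonneg _
  have hL1 : (1 : ℝ) ≤ cL n := by exact_mod_cast one_le_cL n
  have hy0 : (0 : ℝ) < 27 * (cL n : ℝ) ^ (3 : ℕ) := by positivity
  have hg : ((((3 * cL n : ℕ) : ℕ) : ℝ) ^ (3 : ℝ)) = 27 * (cL n : ℝ) ^ (3 : ℕ) := by
    rw [show (3 : ℝ) = ((3 : ℕ) : ℝ) by norm_num, Real.rpow_natCast]; push_cast; ring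
  have hsplit : (27 * (cL n : ℝ) ^ (3 : ℕ)) ^ (1 - ε) ≤ 27 * (cL n : ℝ) ^ (3 : ℕ) * r ^ (-(3 * ε)) := by
    rw [show (1 - ε) = 1 + -ε by ring, Real.rpow_add hy0, Real.rpow_one]
    refine mul_le_mul_of_nonneg_left ?_ hy0.le
    have h3 : r ^ (3 : ℕ) ≤ 27 * (cL n : ℝ) ^ 3 := by
      calc r ^ 3 ≤ (cL n : ℝ) ^ 3 := pow_le_pow_left₀ hr0.le hrL 3
        _ ≤ 27 * (cL n : ℝ) ^ 3 := by nlinarith [pow_nonneg hL0 3]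
    calc (27 * (cL n : ℝ) ^ 3) ^ (-ε) ≤ (r ^ (3 : ℕ)) ^ (-ε) :=
          Real.rpow_le_rpow_of_nonpos (by positivity) h3 (by linarith)
      _ = r ^ (-(3 * ε)) := by rw [← Real.rpow_natCast, ← Real.rpow_mul hr0.le]; push_cast; ring_nf
  rw [hg]
  push_cast
  have hQ0 : (0 : ℝ) ≤ 2 * (Nat.size n : ℝ) * (cR c n * (cNB n * cNB n * cNB n + cL n * cL n * (n * n))) := by
    positivity
  calc 2 * (Nat.size n : ℝ) * (cR c n * (cNB n * cNB n * cNB n + cL n * cL n * (n * n))) *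
        (27 * (cL n : ℝ) ^ 3) ^ (1 - ε)
      ≤ 2 * (Nat.size n : ℝ) * (cR c n * (cNB n * cNB n * cNB n + cL n * cL n * (n * n))) *
        (27 * (cL n : ℝ) ^ 3 * r ^ (-(3 * ε))) := mul_le_mul_of_nonneg_left hsplit hQ0
    _ = 54 * ((Nat.size n : ℝ) * cR c n) * (((cNB n : ℝ) * cL n) ^ 3 + (cL n : ℝ) ^ 5 * (n : ℝ) ^ 2) *
        r ^ (-(3 * ε)) := by ring
    _ ≤ 54 * ((Nat.size n : ℝ) * cR c n) * (270 * r ^ 18) * r ^ (-(3 * ε)) := by gcongr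
    _ = 14580 * ((Nat.size n : ℝ) * cR c n) * (r ^ 18 * r ^ (-(3 * ε))) := by ring

/-- **The total query length of the step**, for `n ≥ 1`:
`2 size n · Q n · (9L² + 1) ≤ 2160 · (size n · cR c n) · r¹⁷`. [folklore] -/
theorem qlen_real {c n : ℕ} (hn : 1 ≤ n) :
    ((2 * Nat.size n * (cR c n * (cNB n * cNB n * cNB n + cL n * cL n * (n * n))) * (9 * (cL n * cL n) + 1) : ℕ) : ℝ) ≤
      2160 * ((Nat.size n : ℝ) * cR c n) * ((n : ℝ) ^ ((1 : ℝ) / 6)) ^ (17 : ℕ) := by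
  obtain ⟨hr1, -, -, -, hP, hW, -⟩ := sixth_root hn
  set r := (n : ℝ) ^ ((1 : ℝ) / 6) with hrdef
  have hL1 : (1 : ℝ) ≤ cL n := by exact_mod_cast one_le_cL n
  push_cast
  have hLL : (9 * ((cL n : ℝ) * cL n) + 1) ≤ 10 * (cL n : ℝ) ^ 2 := by nlinarith
  have hQ0 : (0 : ℝ) ≤ 2 * (Nat.size n : ℝ) * (cR c n * (cNB n * cNB n * cNB n + cL n * cL n * (n * n))) := by
    positivity
  calc 2 * (Nat.size n : ℝ) * (cR c n * (cNB n * cNB n * cNB n + cL n * cL n * (n * n))) * (9 * ((cL n : ℝ) * cL n) + 1)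
      ≤ 2 * (Nat.size n : ℝ) * (cR c n * (cNB n * cNB n * cNB n + cL n * cL n * (n * n))) * (10 * (cL n : ℝ) ^ 2) :=
        mul_le_mul_of_nonneg_left hLL hQ0
    _ = 20 * ((Nat.size n : ℝ) * cR c n) * ((cNB n : ℝ) ^ 3 * (cL n : ℝ) ^ 2 + (n : ℝ) ^ 2 * (cL n : ℝ) ^ 4) := by ring
    _ ≤ 20 * ((Nat.size n : ℝ) * cR c n) * (27 * r ^ 17 + 81 * r ^ 17) := by gcongr
    _ = 2160 * ((Nat.size n : ℝ) * cR c n) * r ^ 17 := by ring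

/-- The budgets at `n = 0` (no rounds at all). [folklore] -/
theorem budget_zero (c : ℕ) (ε : ℝ) :
    ((Tdrv (fun n => 4 * Nat.size n + 3 + 38 + (9 * (cL n * cL n) * 5 + 1) +
      (cR c n * (cNB n * cNB n * cNB n * (96 * (cL n * cL n) + 27) +
        n * n * (cL n * cL n * (cL n * cL n * 46 + 20) + 3) + 9 * (n * n) + 8 + 2) + 1) +
      (3 + (n * n * 20 + 1)) + 1) 0 + 1 : ℕ) : ℝ) = 46 ∧
    ((2 * Nat.size 0 * (cR c 0 * (cNB 0 * cNB 0 * cNB 0 + cL 0 * cL 0 * (0 * 0))) : ℕ) : ℝ) *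
        ((((3 * cL 0 : ℕ) : ℕ) : ℝ) ^ (3 : ℝ)) ^ (1 - ε) = 0 ∧
    ((2 * Nat.size 0 * (cR c 0 * (cNB 0 * cNB 0 * cNB 0 + cL 0 * cL 0 * (0 * 0))) * (9 * (cL 0 * cL 0) + 1) : ℕ) : ℝ) = 0 := by
  simp [Tdrv]

/-- **The budgets of the Negative-Triangle step are subcubic.** With `T`, `Q`, `g = 3L`,
`ℓ = 9L² + 1` of `psNT_spec`: the driver's time `Tdrv T n + 1 = O(n^{17/6} log² n)`, its oracle
ledger `2 size n · Q n · ((3L)³)^{1-ε} = O(n^{3 - ε/2} log² n)` and its total query length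
`O(n^{17/6} log² n)` are all `≤ C (n³)^{1-δ} + C` for `δ = min (ε/12) (1/24)` (VW–W 2018, proof
of Thm. 4.2 with Lemma 4.2: `O(n² · T(n^{1/3}) log W)`, here with parts of `n^{1/6}` nodes).
[folklore] -/
theorem psNT_budget (c : ℕ) (ε : ℝ) (hε : 0 < ε) : ∃ δ : ℝ, 0 < δ ∧ ∃ C : ℝ, ∀ n : ℕ,
    ((Tdrv (fun n => 4 * Nat.size n + 3 + 38 + (9 * (cL n * cL n) * 5 + 1) +
      (cR c n * (cNB n * cNB n * cNB n * (96 * (cL n * cL n) + 27) +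
        n * n * (cL n * cL n * (cL n * cL n * 46 + 20) + 3) + 9 * (n * n) + 8 + 2) + 1) +
      (3 + (n * n * 20 + 1)) + 1) n + 1 : ℕ) : ℝ) ≤ C * ((n : ℝ) ^ (3 : ℝ)) ^ (1 - δ) + C ∧
    ((2 * Nat.size n * (cR c n * (cNB n * cNB n * cNB n + cL n * cL n * (n * n))) : ℕ) : ℝ) *
        ((((3 * cL n : ℕ) : ℕ) : ℝ) ^ (3 : ℝ)) ^ (1 - ε) ≤ C * ((n : ℝ) ^ (3 : ℝ)) ^ (1 - δ) + C ∧
    ((2 * Nat.size n * (cR c n * (cNB n * cNB n * cNB n + cL n * cL n * (n * n))) * (9 * (cL n * cL n) + 1) : ℕ) : ℝ) ≤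
      C * ((n : ℝ) ^ (3 : ℝ)) ^ (1 - δ) + C := by
  obtain ⟨K₁, hK₁, hN₁⟩ := size_le_rpow (by positivity : (0 : ℝ) < ε / 8)
  obtain ⟨K₂, hK₂, hN₂⟩ := size_le_rpow (by norm_num : (0 : ℝ) < 1 / 48)
  set δ := min (ε / 12) (1 / 24) with hδ
  have hδε : δ ≤ ε / 12 := min_le_left _ _
  have hδ1 : δ ≤ 1 / 24 := min_le_right _ _
  have hδ0 : 0 < δ := lt_min (by positivity) (by norm_num)
  have hc4 : (0 : ℝ) ≤ c + 4 := by positivity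
  set C := (48924 * (c + 4) * K₂ ^ 2 + 14580 * (c + 4) * K₁ ^ 2 + 2160 * (c + 4) * K₂ ^ 2 + 46 : ℝ) with hC
  have hA1 : 0 ≤ 48924 * (c + 4) * K₂ ^ 2 := by positivity
  have hA2 : 0 ≤ 14580 * (c + 4) * K₁ ^ 2 := by positivity
  have hA3 : 0 ≤ 2160 * (c + 4) * K₂ ^ 2 := by positivity
  have hC0 : 0 ≤ C := by rw [hC]; positivity
  refine ⟨δ, hδ0, C, fun n => ?_⟩
  set B := ((n : ℝ) ^ (3 : ℝ)) ^ (1 - δ) with hBdef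
  have hB0 : 0 ≤ B := Real.rpow_nonneg (Real.rpow_nonneg (Nat.cast_nonneg _) _) _
  have hCB : 0 ≤ C * B := mul_nonneg hC0 hB0
  rcases Nat.eq_zero_or_pos n with rfl | hn
  · obtain ⟨e1, e2, e3⟩ := budget_zero c ε
    rw [e1, e2, e3]
    refine ⟨?_, ?_, ?_⟩ <;> nlinarith
  obtain ⟨hr1, hrpow, -⟩ := sixth_root hn
  set r := (n : ℝ) ^ ((1 : ℝ) / 6) with hrdef
  have hr0 : 0 < r := by linarith
  have hsR₁ := log_factors (c := c) hn hK₁ (hN₁ n)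
  have hsR₂ := log_factors (c := c) hn hK₂ (hN₂ n)
  have hB : B = r ^ (18 * (1 - δ)) := by
    rw [hBdef, hrpow, ← Real.rpow_mul hr0.le]; ring_nf
  have hB1 : r ^ (17 : ℕ) * r ^ (12 * ((1 : ℝ) / 48)) ≤ B := by
    rw [hB, ← Real.rpow_natCast, ← Real.rpow_add hr0]
    exact Real.rpow_le_rpow_of_exponent_le hr1 (by push_cast; linarith)
  have hB2 : r ^ (18 : ℕ) * r ^ (-(3 * ε)) * r ^ (12 * (ε / 8)) ≤ B := by
    rw [hB, ← Real.rpow_natCast, ← Real.rpow_add hr0, ← Real.rpow_add hr0]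
    exact Real.rpow_le_rpow_of_exponent_le hr1 (by push_cast; linarith)
  have hsR0 : (0 : ℝ) ≤ (Nat.size n : ℝ) * cR c n := by positivity
  refine ⟨?_, ?_, ?_⟩
  · refine (time_real (c := c) hn).trans ?_
    calc 48924 * ((Nat.size n : ℝ) * cR c n) * r ^ 17
        ≤ 48924 * ((c + 4) * K₂ ^ 2 * r ^ (12 * ((1 : ℝ) / 48))) * r ^ 17 := by gcongr
      _ = 48924 * (c + 4) * K₂ ^ 2 * (r ^ 17 * r ^ (12 * ((1 : ℝ) / 48))) := by ring
      _ ≤ 48924 * (c + 4) * K₂ ^ 2 * B := by gcongr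
      _ ≤ C * B + C := by
        have : 48924 * (c + 4) * K₂ ^ 2 * B ≤ C * B := mul_le_mul_of_nonneg_right (by rw [hC]; linarith) hB0
        linarith
  · refine (ledger_real (c := c) hn hε).trans ?_
    calc 14580 * ((Nat.size n : ℝ) * cR c n) * (r ^ 18 * r ^ (-(3 * ε)))
        ≤ 14580 * ((c + 4) * K₁ ^ 2 * r ^ (12 * (ε / 8))) * (r ^ 18 * r ^ (-(3 * ε))) := by gcongr
      _ = 14580 * (c + 4) * K₁ ^ 2 * (r ^ 18 * r ^ (-(3 * ε)) * r ^ (12 * (ε / 8))) := by ring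
      _ ≤ 14580 * (c + 4) * K₁ ^ 2 * B := by gcongr
      _ ≤ C * B + C := by
        have : 14580 * (c + 4) * K₁ ^ 2 * B ≤ C * B := mul_le_mul_of_nonneg_right (by rw [hC]; linarith) hB0
        linarith
  · refine (qlen_real (c := c) hn).trans ?_
    calc 2160 * ((Nat.size n : ℝ) * cR c n) * r ^ 17
        ≤ 2160 * ((c + 4) * K₂ ^ 2 * r ^ (12 * ((1 : ℝ) / 48))) * r ^ 17 := by gcongr
      _ = 2160 * (c + 4) * K₂ ^ 2 * (r ^ 17 * r ^ (12 * ((1 : ℝ) / 48))) := by ring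
      _ ≤ 2160 * (c + 4) * K₂ ^ 2 * B := by gcongr
      _ ≤ C * B + C := by
        have : 2160 * (c + 4) * K₂ ^ 2 * B ≤ C * B := mul_le_mul_of_nonneg_right (by rw [hC]; linarith) hB0
        linarith

end Literature.Computability.FineGrained.NegTriSweep

namespace Literature.Computability.FineGrained

open Cryptography Cryptography.WordRAM APSPPower NegTriSweep

/-! ## APSP `≤₃` Negative Triangle, and VW–W Thm. 1.1 for APSP and Negative Triangle -/

/-- **Discharge of `APSP_fgReducible_negativeTriangle`** (Vassilevska Williams–Williams, J. ACM 65
(2018), Thm. 1.1, direction (1) `≤₃` (3); in print APSP `≤₃` distance product, §2 p. 27:8,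
`≤₃` Negative Triangle, Thm. 4.2): for every weight exponent `c`, APSP with weights in `[-nᶜ, nᶜ]`
reduces subcubically, in the exact sense of `FGReducible` (VVW ICM 2018, Def. 2.1), to Negative
Triangle with weights in `[-n^{6c+11}, n^{6c+11}]` — by the square-and-multiply driver of
`Literature.Computability.FineGrained.APSPPowerDriver` with the verified cell-sweep product step
`NegTriSweep.psNT` (`psNT_spec`, `psNT_budget`).
[cite: VassilevskaWilliamsWilliams2018, Thm. 1.1 (p. 27:3; proof p. 27:22 via Thm. 4.2, p. 27:14)] -/
theorem APSP_fgReducible_negativeTriangle_holds : APSP_fgReducible_negativeTriangle := fun c =>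
  ⟨6 * c + 11, fgReducible_APSP_of_prodSpec (psNT_spec c) (by omega) (by omega)
    (fun n => (wspNT_le n).trans (Nat.pow_le_pow_right (by omega) (by omega))) (psNT_budget c)⟩

/-- **Discharge of `subcubicEquivalent_APSP_negativeTriangle`** (VW–W 2018, Thm. 1.1,
(1) ⟺ (3)): both halves are now theorems (`APSP_fgReducible_negativeTriangle_holds`,
`negativeTriangle_fgReducible_APSP_holds`). [cite: VassilevskaWilliamsWilliams2018, Thm. 1.1 (p. 27:3; p. 27:22)] -/
theorem subcubicEquivalent_APSP_negativeTriangle_holds : subcubicEquivalent_APSP_negativeTriangle :=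
  subcubicEquivalent_APSP_negativeTriangle_of_reductions APSP_fgReducible_negativeTriangle_holds
    negativeTriangle_fgReducible_APSP_holds

/-- **VW–W Thm. 1.1 for APSP and Negative Triangle, unconditionally** ("either all of them have
truly subcubic algorithms, or none of them do"): APSP with polynomially bounded weights is truly
subcubic for every weight exponent iff Negative Triangle is. Discharges the named fact
`trulySubTime_APSP_iff_negativeTriangle` of `Literature.Computability.FineGrained.Conjectures` from
the corrected transfer property of fine-grained reductions
(`trulySubTime_of_fgReducible_of_sizeFitsWord_holds`, VVW ICM 2018, remark after Def. 2.1) and the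
two verified word-RAM reductions (`APSP_fgReducible_negativeTriangle_holds`, Thm. 4.2;
`negativeTriangle_fgReducible_APSP_holds`, Thm. 4.1 and the proof of Thm. 5.1).
[cite: VassilevskaWilliamsWilliams2018, Thm. 1.1 (p. 27:3; restated p. 27:22)] -/
theorem trulySubTime_APSP_iff_negativeTriangle_holds : trulySubTime_APSP_iff_negativeTriangle :=
  trulySubTime_APSP_iff_negativeTriangle_of' trulySubTime_of_fgReducible_of_sizeFitsWord_holds
    APSP_fgReducible_negativeTriangle_holds negativeTriangle_fgReducible_APSP_holds

/-- The conditional, reviewed form `trulySubTime_APSP_iff_negativeTriangle_of_isStandard` of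
`Conjectures` holds as well. [cite: VassilevskaWilliamsICM2018, Prop. 2.1] -/
theorem trulySubTime_APSP_iff_negativeTriangle_of_isStandard_holds :
    trulySubTime_APSP_iff_negativeTriangle_of_isStandard := fun _ _ =>
  trulySubTime_APSP_iff_negativeTriangle_holds

end Literature.Computability.FineGrained
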